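import Summits.BirchSwinnertonDyer.Rank1Residual.X11b.Three.HsiehDescentValuesUnderGalois
import Summits.BirchSwinnertonDyer.Rank1Residual.X11b.Three.HsiehDescentInertia
import Summits.BirchSwinnertonDyer.Rank1Residual.X11b.FrameLambdaUnit
import HarnessLib

/-!
# X11b @ `p = 3`, S29 K4-C2a: the twist relation of a Hsieh witness under one `τ ∈ Gal(ℚ̄_p/ℚ_p)`

HONEST FRAMING (cell `b2b-bsdres`, run/shared/lean/b2b/bsd-rank1-residual/, verbatim in every
file): the goal of the cell is to DELETE the COMBINATION-SHAPED residual classes of the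
Birch–Swinnerton-Dyer formula for ALL analytic-rank `≤ 1` elliptic curves over `ℚ` — assembled
STRICTLY from published theorems — so that the rank-`≤ 1` remainder becomes exactly the
CONSTRUCTION-SHAPED classes, which are TYPED, NOT attempted. This is not "finishing BSD". Team N8/O2
(X11b at `3`); deal S29 (x11b3-lead GEN 8, OWNERS R9-8/R9-29/R9-30/R9-41), package K4 (Step 1–2
glue), seat `b2b-bsdres-x11b3-p7` (gen. 5). WORDING OF RECORD (H45, R9-8): S29 RE-EXPRESSES (t) ⟸ (VR).
The value-reciprocity relation (VR-A) for ONE `σ ∈ Aut(ℂ)` enters as the EXPLICIT HYPOTHESIS `hVRA`;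
nothing discharges it here; the node `Three.HsiehDescentAt₃` is UNCHANGED; O2 OPEN / N8
CONSTRUCTION; nothing booked. THEOREMS ONLY (no definition, no named fact, no `sorry`); every prime `p`.

## What this file proves (plan `s25/K4-INTERFACES.md` v4, hK2 = tree theorem of multr1-p1)

* `exists_twist` — THE TWIST RELATION. Data: a Hsieh witness `(A, Ω_K, C, Ω_p, Q)` (`p ∣ N`), a
  complex period `Ω ≠ 0`, the normalised series `E = ι⁻¹(C)⁻¹ · Q ∈ 𝓞_{ℂ_p}⟦T⟧` (`E ≠ 0`),
  `τ ∈ Gal(ℚ̄_p/ℚ_p)` with its continuous extension `T` to `ℂ_p` (and the coefficient map `φ`),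
  `σ ∈ Aut(ℂ)` with `σι = ιτ` fixing the embeddings of `K`, constants `c, d ≠ 0` and an ideal monomial
  `e` satisfying (VR-A) for `σ`, and a base range point `(χ₀, n₀, ψ₀)` whose point `u = ψ₀(γ)` has
  `‖u − 1‖ < p⁻¹`, `u ≠ 1`. Conclusion: `T Ē = ι⁻¹(d) · (1+T)^a · Ē` in `ℂ_p⟦T⟧` for some `a ∈ ℤ_p`.
  Proof: K4-A `transported_family` supplies the values of `E` and `E^τ` at the points `x^j − 1`,
  `x = τ(u)`, tied by `ι⁻¹(d) · b^j`; after moving the constant `ι⁻¹(d)` to the integral side (the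
  SWAP: onto `E` if `‖ι⁻¹d‖ ≤ 1`, its inverse onto `E^τ` otherwise) multr1-p1's
  `R1.exists_binomialSeries_mul_eq_of_values` ("frames tied along the powers of a principal unit
  differ by `(1+T)^a`, `a ∈ ℤ_p`") gives the relation.

References: [Hsieh2014] Thm. 1; [Weil1956] §1; [Washington1997] §5.1; OWNERS R9-29/R9-30.
-/

noncomputable section

open scoped NumberField
open NumberField IsDedekindDomain Field PowerSeries
open Literature.NumberTheory.GaloisRepresentations Literature.NumberTheory.EllipticCurves
open Summit.BirchSwinnertonDyer.Rank1Residual.X11b.LambdaSupply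
open Summit.BirchSwinnertonDyer.Rank1Residual.X11b.Three.LambdaSupply

namespace Summit.BirchSwinnertonDyer.Rank1Residual.X11b.Three.RangeTransport

variable {K : Type} [Field K] [NumberField K] {p : ℕ} [Fact p.Prime] {N : ℕ}

/-- The image in `ℂ_p⟦T⟧` of the coefficientwise `T`-image `E.map φ` is `Ē.map T`. [folklore] -/
theorem map_map_restrict {T : ℂ_[p] →+* ℂ_[p]} {φ : PadicComplexInt p →+* PadicComplexInt p}
    (hφ : ∀ y : PadicComplexInt p, (φ y : ℂ_[p]) = T y) (E : PowerSeries 𝓞_ℂ_[p]) :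
    (E.map φ).map (PadicComplexInt p).subtype = (E.map (PadicComplexInt p).subtype).map T := by
  ext k
  simp only [coeff_map, ValuationSubring.subtype_apply, hφ]

/-- The (VR-A) monomial `ι⁻¹(∏_v σ(χ₀(ϖ_v))^{e_v})` is non-zero. [folklore] -/
theorem coe_symm_prod_ne_zero (ι : PadicAlgCl p ≃+* ℂ) (σ : ℂ ≃ₐ[ℚ] ℂ)
    (e : HeightOneSpectrum (𝓞 K) →₀ ℤ) (χ₀ : HeckeCharacter K) :
    ((ι.symm (e.prod fun v k ↦ σ (χ₀.valueAtUniformizer v) ^ k) : PadicAlgCl p) : ℂ_[p]) ≠ 0 := by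
  rw [PadicComplex.coe_eq, map_ne_zero_iff _ (algebraMap (PadicAlgCl p) ℂ_[p]).injective,
    map_ne_zero_iff _ ι.symm.injective, Finsupp.prod]
  exact Finset.prod_ne_zero_iff.2 fun v _ ↦ zpow_ne_zero _
    ((map_ne_zero_iff _ σ.injective).2 (HeckeCharacter.valueAtUniformizer_ne_zero' χ₀ v))

/-- **The twist relation of a Hsieh witness under one Galois automorphism** (see the module
docstring for the data). GIVEN the (VR-A) relation `hVRA` for `σ` with constants `c, d ≠ 0` and
monomial `e`: `T Ē = ι⁻¹(d) · (1+T)^a · Ē` for some `a ∈ ℤ_p`, where `E = ι⁻¹(C)⁻¹ Q`.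
[cite: Hsieh2014, Thm. 1 (arXiv:1112.1580 p. 4)] [cite: Washington1997, §5.1] -/
theorem exists_twist (ι : PadicAlgCl p ≃+* ℂ) {𝔭 : HeightOneSpectrum (𝓞 K)}
    {κ : ZpExtension K p} {γ : absoluteGaloisGroup K} {f : CuspForm (CongruenceSubgroup.Gamma0 N) 2}
    {A : ℝ} {ΩK C : ℂ} {Ωp : ℂ_[p]} {Q : PowerSeries 𝓞_ℂ_[p]}
    (hQ : IsHsiehLFunction ι 𝔭 κ γ f A ΩK C Ωp Q) (hpN : p ∣ N) {Ω : ℂ} (hΩ : Ω ≠ 0)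
    (hθ : (((ι.symm (((p : ℂ) / (16 * (A : ℂ) ^ 2)) * (Ω / ΩK) ^ 4) : PadicAlgCl p) : ℂ_[p]) * Ωp ^ 4) ≠ 0)
    (hC : ((ι.symm C : PadicAlgCl p) : ℂ_[p]) ≠ 0)
    (hK : ∀ w : InfinitePlace K, ¬ w.IsReal)
    {τ : PadicAlgCl p ≃ₐ[ℚ_[p]] PadicAlgCl p} {T : ℂ_[p] →+* ℂ_[p]} (hT : Continuous T)
    (hTτ : ∀ x : PadicAlgCl p, T x = τ x)
    {φ : PadicComplexInt p →+* PadicComplexInt p} (hφ : ∀ y : PadicComplexInt p, (φ y : ℂ_[p]) = T y)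
    {σ : ℂ ≃ₐ[ℚ] ℂ} (hστ : ∀ z : PadicAlgCl p, σ (ι z) = ι (τ z))
    (hσK : ∀ (φ : K →+* ℂ) (k : K), σ (φ k) = φ k)
    {c d : ℂ} {e : HeightOneSpectrum (𝓞 K) →₀ ℤ} (hc : c ≠ 0) (hd : d ≠ 0)
    (hVRA : ∀ (χ : HeckeCharacter K) (n : ℕ), 0 < n →
      (∀ v : HeightOneSpectrum (𝓞 K), χ.IsUnramifiedAt v) →
      ∀ hχ : χ.HasInfinityType (fun _ ↦ (n : ℤ)) (fun _ ↦ -(n : ℤ)),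
        σ (bdpInterpolationValue p f 𝔭 χ n Ω) =
          d * c ^ n * (e.prod fun v k ↦ (hχ.autConj σ).valueAtUniformizer v ^ k) *
            bdpInterpolationValue p f 𝔭 (hχ.autConj σ) n Ω)
    {χ₀ : HeckeCharacter K} {n₀ : ℕ} (hn₀ : 0 < n₀)
    (hunr₀ : ∀ v : HeightOneSpectrum (𝓞 K), χ₀.IsUnramifiedAt v)
    (hχ₀ : χ₀.HasInfinityType (fun _ ↦ (n₀ : ℤ)) (fun _ ↦ -(n₀ : ℤ)))
    {ψ₀ : absoluteGaloisGroup K →ₜ* (PadicAlgCl p)ˣ}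
    (hav₀ : IsPAdicAvatarOf ι χ₀ ((FramedRep.unitsContinuousMulEquivOfUnique (Fin 1) (PadicAlgCl p) :
      (PadicAlgCl p)ˣ →ₜ* GL (Fin 1) (PadicAlgCl p)).comp ψ₀))
    (hfac₀ : FactorsThroughZp κ ((FramedRep.unitsContinuousMulEquivOfUnique (Fin 1) (PadicAlgCl p) :
      (PadicAlgCl p)ˣ →ₜ* GL (Fin 1) (PadicAlgCl p)).comp ψ₀))
    (hu : ‖(((ψ₀ γ : (PadicAlgCl p)ˣ) : PadicAlgCl p) : ℂ_[p]) - 1‖ < (p : ℝ)⁻¹)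
    (hu1 : ((ψ₀ γ : (PadicAlgCl p)ˣ) : PadicAlgCl p) ≠ 1)
    {E : PowerSeries 𝓞_ℂ_[p]} (hE0 : E ≠ 0)
    (hE : ∀ k, ((coeff k E : 𝓞_ℂ_[p]) : ℂ_[p]) =
      (((ι.symm C : PadicAlgCl p) : ℂ_[p]))⁻¹ * ((coeff k Q : 𝓞_ℂ_[p]) : ℂ_[p])) :
    ∃ a : ℤ_[p], (E.map (PadicComplexInt p).subtype).map T =
      PowerSeries.C ((ι.symm d : PadicAlgCl p) : ℂ_[p]) *
        ((((binomialSeries ℤ_[p] a).map (R1.toCpInt p)) * E).map (PadicComplexInt p).subtype) := by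
  have hp : p.Prime := Fact.out
  -- abbreviations
  set e₁ := (FramedRep.unitsContinuousMulEquivOfUnique (Fin 1) (PadicAlgCl p) :
    (PadicAlgCl p)ˣ →ₜ* GL (Fin 1) (PadicAlgCl p)) with he₁
  set CC : ℂ_[p] := ((ι.symm C : PadicAlgCl p) : ℂ_[p]) with hCC
  set θ : ℂ_[p] := (((ι.symm (((p : ℂ) / (16 * (A : ℂ) ^ 2)) * (Ω / ΩK) ^ 4) : PadicAlgCl p) :
    ℂ_[p]) * Ωp ^ 4) with hθdef
  set dd : ℂ_[p] := ((ι.symm d : PadicAlgCl p) : ℂ_[p]) with hdd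
  set u : ℂ_[p] := (((ψ₀ γ : (PadicAlgCl p)ˣ) : PadicAlgCl p) : ℂ_[p]) with hudef
  set x : ℂ_[p] := ((τ ((ψ₀ γ : (PadicAlgCl p)ˣ) : PadicAlgCl p) : PadicAlgCl p) : ℂ_[p]) with hxdef
  set b : ℂ_[p] := ((((ι.symm c : PadicAlgCl p) : ℂ_[p]) * T θ * θ⁻¹) ^ n₀ *
    ((ι.symm (e.prod fun v k ↦ σ (χ₀.valueAtUniformizer v) ^ k) : PadicAlgCl p) : ℂ_[p])) with hbdef
  have hdd0 : dd ≠ 0 := by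
    rw [hdd, PadicComplex.coe_eq, map_ne_zero_iff _ (algebraMap (PadicAlgCl p) ℂ_[p]).injective,
      map_ne_zero_iff _ ι.symm.injective]; exact hd
  have hTinj : Function.Injective T := (extension_bijective hT hTτ).1
  have hb0 : b ≠ 0 := by
    refine mul_ne_zero (pow_ne_zero _ (mul_ne_zero (mul_ne_zero ?_ ?_) (inv_ne_zero hθ)))
      (coe_symm_prod_ne_zero ι σ e χ₀)
    · rw [PadicComplex.coe_eq, map_ne_zero_iff _ (algebraMap (PadicAlgCl p) ℂ_[p]).injective,
        map_ne_zero_iff _ ι.symm.injective]; exact hc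
    · exact (map_ne_zero_iff T hTinj).2 hθ
  -- the point `x = τ(u)`: `‖x − 1‖ = ‖u − 1‖ < p⁻¹`, `x ≠ 1`
  have hxu : x = T u := by rw [hxdef, hudef, hTτ]
  have hx : ‖x - 1‖ < (p : ℝ)⁻¹ := by
    rw [hxu, ← map_one T, ← map_sub, norm_extension hT hTτ]; exact hu
  have hx1 : x ≠ 1 := by
    intro h1
    rw [hxu, ← map_one T] at h1
    have h2 : u = 1 := hTinj h1
    exact hu1 ((algebraMap (PadicAlgCl p) ℂ_[p]).injective (h2.trans (map_one _).symm))
  have hp1 : (p : ℝ)⁻¹ < 1 := inv_lt_one_of_one_lt₀ (by exact_mod_cast hp.one_lt)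
  have hxlt : ‖x - 1‖ < 1 := hx.trans hp1
  have hult : ‖u - 1‖ < 1 := hu.trans hp1
  have hxj : ∀ j : ℕ, ‖x ^ j - 1‖ < 1 := fun j ↦ (R1.norm_pow_sub_one_le hxlt j).trans_lt hxlt
  have huj : ∀ j : ℕ, ‖u ^ j - 1‖ < 1 := fun j ↦ (R1.norm_pow_sub_one_le hult j).trans_lt hult
  -- E-values from Q-values
  have hEval : ∀ {y v : ℂ_[p]}, IntSeries.HasValueAt Q y v → IntSeries.HasValueAt E y (CC⁻¹ * v) :=
    fun h ↦ hasValueAt_of_coeff_eq_mul hE h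
  -- the values along the family, `j ≥ 1`
  have hfam : ∀ j : ℕ, 0 < j → ∃ V : ℂ_[p], IntSeries.HasValueAt E (x ^ j - 1) V ∧
      IntSeries.HasValueAt (E.map φ) (x ^ j - 1) (dd * b ^ j * V) := by
    intro j hj
    obtain ⟨hi, hii, hiii⟩ := transported_family ι hQ hpN hΩ hθ hK hTτ hστ hσK hVRA hn₀ hunr₀ hχ₀
      hav₀ hfac₀ hj
    -- the untransported `j`-th point is a range point
    have hjn : 0 < j * n₀ := Nat.mul_pos hj hn₀
    have hQj : IntSeries.HasValueAt Q (u ^ j - 1) (CC * θ ^ (j * n₀) *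
        ((ι.symm (bdpInterpolationValue p f 𝔭 (χ₀ ^ j) (j * n₀) Ω) : PadicAlgCl p) : ℂ_[p])) := by
      have h := hasValueAt_normalForm ι hQ hpN hΩ hjn (fun v ↦ isUnramifiedAt_pow' (hunr₀ v) j)
        (hasInfinityType_pow_range hχ₀ j) (isPAdicAvatarOf_pow ι hav₀ (fun v _ ↦ hunr₀ v) j)
        (factorsThroughZp_unitsChar_pow κ hfac₀ j)
      rwa [avatarValueAt_unitsChar_pow, avatarValueAt_unitsChar] at h
    refine ⟨CC⁻¹ * (CC * θ ^ (j * n₀) * ((ι.symm (bdpInterpolationValue p f 𝔭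
      ((hasInfinityType_pow_range hχ₀ j).autConj σ) (j * n₀) Ω) : PadicAlgCl p) : ℂ_[p])),
      hEval hi, ?_⟩
    have h2 := hasValueAt_map_extension hT hφ (hEval hQj)
    rw [hiii, map_mul, map_inv₀, hii] at h2
    simp only [← hθdef] at h2
    simp only [← hbdef, ← hCC, ← hdd] at h2
    have hTC : T CC ≠ 0 := (map_ne_zero_iff T hTinj).2 hC
    convert h2 using 1
    field_simp
  by_cases hd1 : ‖dd‖ ≤ 1
  · -- SWAP the constant onto `E`: `Q₁ = ι⁻¹(d)·E`, `Q₁' = E^τ`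
    set dₒ : 𝓞_ℂ_[p] := ⟨dd, Literature.NumberTheory.LFunctions.Dwork.mem_unitBall.2 hd1⟩ with hdₒ
    have hdₒc : ((dₒ : 𝓞_ℂ_[p]) : ℂ_[p]) = dd := rfl
    set Q₁ : PowerSeries 𝓞_ℂ_[p] := PowerSeries.C dₒ * E with hQ₁
    choose V hV using fun j ↦ intSeries_exists_hasValueAt Q₁ (hxj j)
    choose V' hV' using fun j ↦ intSeries_exists_hasValueAt (E.map φ) (hxj j)
    have hrel : ∀ j, 0 < j → V' j = b ^ j * V j := by
      intro j hj
      obtain ⟨V₀, h1, h2⟩ := hfam j hj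
      have h1' : IntSeries.HasValueAt Q₁ (x ^ j - 1) (dd * V₀) :=
        hasValueAt_of_coeff_eq_mul (fun k ↦ by rw [hQ₁, coeff_C_mul, MulMemClass.coe_mul, hdₒc]) h1
      rw [(hV' j).unique h2, (hV j).unique h1']
      ring
    obtain ⟨a, hK2⟩ := R1.exists_binomialSeries_mul_eq_of_values hx hx1 hb0 hV hV' hrel
    rcases hK2 with ⟨hQ₁0, -⟩ | hrelS
    · exfalso
      have hCd : PowerSeries.C dₒ ≠ 0 := by
        intro h0
        have : dₒ = 0 := by
          have := congrArg constantCoeff h0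
          rwa [constantCoeff_C, map_zero] at this
        exact hdd0 (by rw [← hdₒc, this]; rfl)
      exact hE0 ((mul_eq_zero.1 hQ₁0).resolve_left hCd)
    · refine ⟨a, ?_⟩
      rw [← map_map_restrict hφ, hrelS, hQ₁, map_mul, map_mul, map_mul, map_C,
        ValuationSubring.subtype_apply, hdₒc]
      ring
  · -- SWAP the inverse constant onto `E^τ`: `Q₁ = E`, `Q₁' = ι⁻¹(d)⁻¹·E^τ`
    have hd1' : ‖dd⁻¹‖ ≤ 1 := by
      rw [norm_inv]; exact inv_le_one_of_one_le₀ (le_of_lt (lt_of_not_ge hd1))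
    set dₒ : 𝓞_ℂ_[p] := ⟨dd⁻¹, Literature.NumberTheory.LFunctions.Dwork.mem_unitBall.2 hd1'⟩ with hdₒ
    have hdₒc : ((dₒ : 𝓞_ℂ_[p]) : ℂ_[p]) = dd⁻¹ := rfl
    set Q₁' : PowerSeries 𝓞_ℂ_[p] := PowerSeries.C dₒ * E.map φ with hQ₁'
    choose V hV using fun j ↦ intSeries_exists_hasValueAt E (hxj j)
    choose V' hV' using fun j ↦ intSeries_exists_hasValueAt Q₁' (hxj j)
    have hrel : ∀ j, 0 < j → V' j = b ^ j * V j := by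
      intro j hj
      obtain ⟨V₀, h1, h2⟩ := hfam j hj
      have h2' : IntSeries.HasValueAt Q₁' (x ^ j - 1) (dd⁻¹ * (dd * b ^ j * V₀)) :=
        hasValueAt_of_coeff_eq_mul (fun k ↦ by rw [hQ₁', coeff_C_mul, MulMemClass.coe_mul, hdₒc]) h2
      rw [(hV' j).unique h2', (hV j).unique h1]
      field_simp
    obtain ⟨a, hK2⟩ := R1.exists_binomialSeries_mul_eq_of_values hx hx1 hb0 hV hV' hrel
    rcases hK2 with ⟨hQ₁0, -⟩ | hrelS
    · exact absurd hQ₁0 hE0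
    · refine ⟨a, ?_⟩
      have h3 : PowerSeries.C dd⁻¹ * (E.map (PadicComplexInt p).subtype).map T =
          (((binomialSeries ℤ_[p] a).map (R1.toCpInt p)) * E).map (PadicComplexInt p).subtype := by
        have := congrArg (PowerSeries.map (PadicComplexInt p).subtype) hrelS
        rwa [hQ₁', map_mul, map_C, ValuationSubring.subtype_apply, hdₒc, map_map_restrict hφ] at this
      rw [← h3, ← mul_assoc, ← map_mul, mul_inv_cancel₀ hdd0, map_one, one_mul]

end Summit.BirchSwinnertonDyer.Rank1Residual.X11b.Three.RangeTransport
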